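import Summits.FinalStateConjecture.FinalStateConjecture.Theses.KillingDefectSpacetimeBound

/-!
# Line `birth` (file `birth.lean`) — birth skeleton for the crux `DefectCoercivity` (stmt-FinalStateConjecture-18632)

Route `KillingDefectSpacetimeBound` (route-FinalStateConjecture-KillingDefectSpacetimeBound), crux K3 (rank 4)
`Summit.FinalStateConjecture.FinalStateConjecture.Theses.KillingDefectSpacetimeBound.DefectCoercivity`
(QUANTITATIVE RIGIDITY: on a window `[τ₁, τ₁+L]` of an order-`k+2` hyperboloidal Kerr-star foliation on which the
leaf deviation `d_{k+2} ≤ δ₀`, the squared leaf deviation `d_k(σ)²` on the middle half is bounded by `C ×` the full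
LE size of order `k+2` of the stationarity defect `π = ∂₀(Ψ^* g)` over the window).

THE LINE (planner, skeleton-register 2026-08-17): factor the crux through ONE intermediate quantity, the
**LE-weighted `Cᵏ` time-oscillation of the chart metric on a unit band**,

  `Osc_k(σ, s) = leSupCkENorm (band_σ) k (x ↦ (Ψ^* g)(x + s e₀) − (Ψ^* g)(x))`   (`|s| ≤ L/4 − 2`),

so that the composition is pure `ℝ≥0∞` arithmetic and the two stubs separate cleanly into ANALYSIS and RIGIDITY:

* `stub_timeOscillation` (size M–L, real analysis, believed TRUE as typed): `Osc_k(σ, s)² ≤ C₁ · defectLE (k+2)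
  (window)`. Mechanism: `D^m[(g(·+se₀) − g)](x) = ∫₀ˢ D^m π(x + t e₀) dt` (FTC along `∂₀`; the chart domain
  `{r(a₀,·) > M₀}` is invariant under `x⁰`-translation and the segment stays in the late region), Cauchy–Schwarz in
  `t` (a factor `|s| ≤ L/4`), then the 3-dimensional Sobolev embedding `H² ↪ C⁰` on balls / half-balls of radius
  `ρ(M₀, a₀) ≤ 1` of the leaves `{x⁰ = const} ∩ {r > M₀}` (exterior of the ellipsoid `r(a₀,·) = M₀`, uniformly
  Lipschitz boundary), costing exactly the two orders `k ↦ k+2`; the LE weights `(1+‖y‖)⁻¹` at `x` and on the ball are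
  comparable (factor 2), and the chart-time spread of a ball is `≤ Lip(h♯_{4M₀}) ρ ≤ 1`, so the tube lies in the
  window band `(τ₁, τ₁+L)` because `σ + s ∈ [τ₁ + 2, τ₁ + L − 2]`.
* `stub_oscillationRigidity` (HARDEST, size XL, the physics of the crux): `d_k(σ)² ≤ C₂ · sup_s Osc_k(σ, s)²` under
  the same a-priori smallness `d_{k+2} ≤ δ₀` on the window. Mechanism: the smoothly time-averaged metric
  `ḡ(x) = ∫ g(x − (τ(x) − σ − u)e₀) ψ(u) du` is EXACTLY `∂₀`-stationary on the band, `‖g − ḡ‖_{Cᵏ_w} ≲ sup_s Osc_k`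
  LINEARLY (every `∂₀`-slot produced by the chain rule is integrated by parts onto `ψ`, so only increments of
  `D^{≤k} g` with `|s| ≤ 1 + rad(supp ψ)` enter), `Ric(ḡ) = Ric(ḡ) − Ric(g) = O(‖g − ḡ‖_{C²})`; then a quantitative
  perturbative no-hair estimate for exactly stationary, approximately vacuum metrics `δ₀`-close to Kerr on
  `{r > M₀} × [σ, σ+1]` (linearised: real-axis/zero-frequency mode stability of Kerr incl. `σ = 0`,
  AnderssonHafnerWhiting2022; nonlinear small-data uniqueness, AlexakisIonescuKlainerman2010) bounds the distance of
  `ḡ` — hence of `g` — to the Kerr family modulo re-charting.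

`DefectCoercivity_of` (no `sorry` of its own; it invokes the two stubs by name) composes them: `d_k(σ)² ≤ C₂ ⨆_s Osc² ≤ C₂ (C₁ · defect) = (C₂ C₁) · defect`,
with `k₃, δ₀, L` those of the rigidity stub and `C = C₂ C₁`.

HARDEST STUB: `stub_oscillationRigidity`. Why it might fail (= the crux's own risk, isolated): zero modes and
weights — the equal LE weights `(1+‖y‖)⁻¹` on both sides may under-weight far-zone mass-aspect / gauge drift, and
elliptic `Cᵏ → Cᵏ` (integer, non-Hölder) bookkeeping may cost a power (`d_k ≲ Osc^θ`, `θ < 1`) unless the spare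
`C^{k+6}` regularity of the order-`k+2` foliation is traded in; a genuinely stationary non-Kerr vacuum region
`δ₀`-close to Kerr on the WHOLE band `{r > M₀}` (horizon collar to the AF end) would refute it (none is known:
AIK perturbative uniqueness). The relation to the route's foreseen split (`stub_midzone_fit → stub_zone_transport`,
route header TWO-LAYER PLAN): that split cuts in SPACE (middle zone first) and needs an exterior stationary-extension
uniqueness statement to transport; this one cuts by MECHANISM (defect → oscillation → rigidity) on the whole band and
keeps the zone question inside the rigidity stub, so the composition is arithmetic.

BC3 (planner folder `bc/`): `lean check` of this file rc 0 with `sorry` ONLY in the two `stub_*` bodies (2 warnings,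
`DefectCoercivity_of` is the only theorem whose head is the crux); the four probes
`stub → DefectCoercivity`, `stub → FinalStateConjecture` (`first | exact? | simpa | aesop`, 400k heartbeats,
importing only the route file) all FAIL (see `Lines/birth.md`). Disproof used: none (no `Disproof.lean` / no crux
workfiles exist for stmt-FinalStateConjecture-18632 at registration time).
-/

-- `Summit.<Summit>.<Problem>`: for the single-conjunct summit the duplicate component is mandated.
set_option linter.dupNamespace false
set_option linter.unusedVariables false

noncomputable section

namespace Summit.FinalStateConjecture.FinalStateConjecture.Cruxes.DefectCoercivity.Birth

open Literature.Geometry.Lorentzian MeasureTheory Filter Set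
open Summit.FinalStateConjecture.FinalStateConjecture.Theses.KillingDefectSpacetimeBound
open scoped ENNReal Manifold ContDiff Topology

/-! ## The registered stubs -/

/-- **Stub A — time oscillation is controlled by the spacetime stationarity defect** (real analysis; size M–L).
For every order `k`, bounds `(Λ, χ, M₀, a₀)` and window length `L` there is `C₁` with: on an order-`k+2`
hyperboloidal Kerr-star foliation, for every window start `τ₁ ≥ τ₀`, every band time `σ` in the middle half
`[τ₁ + L/4, τ₁ + 3L/4]` and every shift `|s| ≤ L/4 − 2`, the squared LE-weighted `Cᵏ` sup size over the unit band
`{σ ≤ τ ≤ σ+1}` of the increment `x ↦ (Ψ^* g)(x + s e₀) − (Ψ^* g)(x)` is at most `C₁ ×` the full LE size of order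
`k+2` of `π = ∂₀(Ψ^* g)` over the window `(τ₁, τ₁+L)`. Why true: FTC along `e₀` + Cauchy–Schwarz in time + 3-d
Sobolev `H² ↪ C⁰` on (half-)balls of the leaves inside the Lipschitz domain `{r(a₀,·) > M₀}`, weights comparable on
unit balls, tube inside the window (module docstring); vacuous for `L < 8` (empty shift range) and for parameters
admitting no foliation. Why it might fail: only through formalisation cost (smoothness of `chartMetricExtend` on the
open late region from `IsLateChart.contMDiff`; uniform interior/boundary Sobolev constants on the ellipsoid
exterior). Sources: LindbladTohaneanu2020 ((1.6)–(1.8), the LE norms); Anderson2004 (§5, chart norms); Adams–Fournier,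
Sobolev Spaces, Thm. 4.12 (cone condition). -/
theorem stub_timeOscillation :
    ∀ (k : ℕ) (Λ χ M₀ a₀ L : ℝ), ∃ C₁ : ℝ, ∀ (X : Type) [TopologicalSpace X] [ChartedSpace E3 X] [IsManifold (𝓡 3) ∞ X] [T2Space X] [SecondCountableTopology X] [ConnectedSpace X], ∀ D ∈ admissibleVacuumData X, ∀ (𝒟 : VacuumCauchyDevelopment D) (τ₀ : ℝ) (Ψ : (Kerr.hypStarBackground M₀ a₀).domain → 𝒟.carrier), 𝒟.toSpacetime.IsHypKerrFoliation (k + 2) Λ χ M₀ a₀ τ₀ Ψ → ∀ τ₁ : ℝ, τ₀ ≤ τ₁ → ∀ σ ∈ Set.Icc (τ₁ + L / 4) (τ₁ + 3 * L / 4), ∀ s ∈ Set.Icc (-(L / 4 - 2)) (L / 4 - 2), leSupCkENorm (Subtype.val '' (Kerr.hypStarBackground M₀ a₀).timeBand (Set.Icc σ (σ + 1))) k (fun x ↦ 𝒟.toSpacetime.chartMetricExtend (Kerr.hypStarBackground M₀ a₀) Ψ (x + s • E4.basisVector 0) - 𝒟.toSpacetime.chartMetricExtend (Kerr.hypStarBackground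 M₀ a₀) Ψ x) ^ 2 ≤ ENNReal.ofReal C₁ * 𝒟.toSpacetime.defectLE (Kerr.hypStarBackground M₀ a₀) Ψ (k + 2) (Set.Ioo τ₁ (τ₁ + L)) Set.univ := by
  sorry

/-- **Stub B — oscillation rigidity (quantitative local no-hair from sup time-oscillation; HARDEST, size XL).**
There is `k₃` such that for `k ≥ k₃` and all `(Λ, χ, M₀, a₀)` there are `δ₀ > 0`, `L ≥ 4` (the prover takes
`L ≥ 12`, so that the shift range `[−(L/4−2), L/4−2] ⊇ [−1, 1]`) and `C₂ ≥ 0` with: on an order-`k+2` foliation and a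
window `[τ₁, τ₁+L]` on which `d_{k+2} ≤ δ₀`, for every `σ` in the middle half, `d_k(σ)² ≤ C₂ × sup_{|s| ≤ L/4−2}`
(squared LE-weighted `Cᵏ` band oscillation at shift `s`). Why plausibly true: smooth time-averaging along the chart
time gives an exactly `∂₀`-stationary `ḡ` with `‖g − ḡ‖_{Cᵏ_w(band)} ≲ sup_s Osc_k` linearly and `Ric ḡ = O(g − ḡ)`;
exactly stationary vacuum regions `δ₀`-close to Kerr on the whole band are Kerr (perturbative uniqueness,
AlexakisIonescuKlainerman2010), and the linearised statement is zero-frequency mode stability modulo moduli ⊕ gauge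
(AnderssonHafnerWhiting2022), which should upgrade to a linear estimate by a contradiction/compactness argument plus
weighted elliptic theory for the stationary reduction. Why it might fail: the equal LE weights `(1+‖y‖)⁻¹` on both
sides (far-zone mass-aspect / gauge drift may be under-weighted, breaking linearity), integer-`Cᵏ` elliptic loss, and
local stationary vacuum hair near the horizon collar if the band did not reach the AF end (it does: the band is all of
`{r > M₀}`); arXiv:1010.2421 (Ionescu–Klainerman local extension counterexamples) is the shape of a refutation.
Sources: AlexakisIonescuKlainerman2010; AnderssonHafnerWhiting2022; arXiv:1010.2421; Anderson2004. -/
theorem stub_oscillationRigidity :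
    ∃ k₃ : ℕ, ∀ k : ℕ, k₃ ≤ k → ∀ (Λ χ M₀ a₀ : ℝ), ∃ (δ₀ L C₂ : ℝ), 0 < δ₀ ∧ 4 ≤ L ∧ 0 ≤ C₂ ∧ ∀ (X : Type) [TopologicalSpace X] [ChartedSpace E3 X] [IsManifold (𝓡 3) ∞ X] [T2Space X] [SecondCountableTopology X] [ConnectedSpace X], ∀ D ∈ admissibleVacuumData X, ∀ (𝒟 : VacuumCauchyDevelopment D) (τ₀ : ℝ) (Ψ : (Kerr.hypStarBackground M₀ a₀).domain → 𝒟.carrier), 𝒟.toSpacetime.IsHypKerrFoliation (k + 2) Λ χ M₀ a₀ τ₀ Ψ → ∀ τ₁ : ℝ, τ₀ ≤ τ₁ → (∀ τ ∈ Set.Icc τ₁ (τ₁ + L), 𝒟.toSpacetime.leafDev M₀ a₀ Ψ χ (k + 2) τ ≤ ENNReal.ofReal δ₀) → ∀ σ ∈ Set.Icc (τ₁ + L / 4) (τ₁ + 3 * L / 4), 𝒟.toSpacetime.leafDev M₀ a₀ Ψ χ k σ ^ 2 ≤ ENNReal.ofReal C₂ * ⨆ s ∈ Set.Icc (-(L /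 4 - 2)) (L / 4 - 2), leSupCkENorm (Subtype.val '' (Kerr.hypStarBackground M₀ a₀).timeBand (Set.Icc σ (σ + 1))) k (fun x ↦ 𝒟.toSpacetime.chartMetricExtend (Kerr.hypStarBackground M₀ a₀) Ψ (x + s • E4.basisVector 0) - 𝒟.toSpacetime.chartMetricExtend (Kerr.hypStarBackground M₀ a₀) Ψ x) ^ 2 := by
  sorry

/-! ## The composition (no `sorry` of its own; the stubs enter BY NAME) -/

/-- **THE SKELETON THEOREM — the line concludes the crux BY NAME.** `DefectCoercivity` from the two DECLARED stubs
`stub_oscillationRigidity` (gives `k₃, δ₀, L, C₂`) and `stub_timeOscillation` (gives `C₁` for that `L`), with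
`C = C₂ · C₁`; the body is pure `ℝ≥0∞` arithmetic (`iSup₂_le`, `gcongr`, `ENNReal.ofReal_mul`) and contains no
`sorry` (the only `sorry`s of the file are the two stub bodies; registrar format as in `Cruxes/DyadicCapture/Lines/birth.lean`). -/
theorem DefectCoercivity_of :
    Summit.FinalStateConjecture.FinalStateConjecture.Theses.KillingDefectSpacetimeBound.DefectCoercivity := by
  obtain ⟨k₃, hk₃⟩ := stub_oscillationRigidity
  refine ⟨k₃, fun k hk Λ χ M₀ a₀ ↦ ?_⟩
  obtain ⟨δ₀, L, C₂, hδ₀, hL, hC₂, H⟩ := hk₃ k hk Λ χ M₀ a₀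
  obtain ⟨C₁, H₁⟩ := stub_timeOscillation k Λ χ M₀ a₀ L
  refine ⟨δ₀, L, C₂ * C₁, hδ₀, hL, ?_⟩
  intro X _ _ _ _ _ _ D hD 𝒟 τ₀ Ψ hΨ τ₁ hτ₁ hnear σ hσ
  calc 𝒟.toSpacetime.leafDev M₀ a₀ Ψ χ k σ ^ 2
      ≤ ENNReal.ofReal C₂ * ⨆ s ∈ Set.Icc (-(L / 4 - 2)) (L / 4 - 2),
          leSupCkENorm (Subtype.val '' (Kerr.hypStarBackground M₀ a₀).timeBand (Set.Icc σ (σ + 1))) k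
            (fun x ↦ 𝒟.toSpacetime.chartMetricExtend (Kerr.hypStarBackground M₀ a₀) Ψ (x + s • E4.basisVector 0) -
              𝒟.toSpacetime.chartMetricExtend (Kerr.hypStarBackground M₀ a₀) Ψ x) ^ 2 :=
        H X D hD 𝒟 τ₀ Ψ hΨ τ₁ hτ₁ hnear σ hσ
    _ ≤ ENNReal.ofReal C₂ * (ENNReal.ofReal C₁ *
          𝒟.toSpacetime.defectLE (Kerr.hypStarBackground M₀ a₀) Ψ (k + 2) (Set.Ioo τ₁ (τ₁ + L)) Set.univ) := by
        gcongr
        exact iSup₂_le fun s hs ↦ H₁ X D hD 𝒟 τ₀ Ψ hΨ τ₁ hτ₁ σ hσ s hs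
    _ = ENNReal.ofReal (C₂ * C₁) *
          𝒟.toSpacetime.defectLE (Kerr.hypStarBackground M₀ a₀) Ψ (k + 2) (Set.Ioo τ₁ (τ₁ + L)) Set.univ := by
        rw [ENNReal.ofReal_mul hC₂, mul_assoc]

end Summit.FinalStateConjecture.FinalStateConjecture.Cruxes.DefectCoercivity.Birth

end
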